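import Literature.Probability.RandomPlanarGeometry.SAWCountZdWeightedCensus
import Literature.Probability.RandomPlanarGeometry.SAWCountZdShapeCensusKeys
import Mathlib.Combinatorics.Colex
import HarnessLib

/-!
# The FAST shape census: the whole weight vector of a leaf in one stroke (inclusion–exclusion over the zero-block up-sets), and census values certified in pieces

Topic `Literature/Probability/RandomPlanarGeometry` (upgrade (U2) of the «SYMBOL POLYNOMIALITY» census chain: a-p3 g20's pruned depth-first search
`SAWPulledLargeForceExpansionZdWordSearch.lean` (`dfsV`/`dfsN`, `lts`, `st`, `card_TL_class`), the shape census engine `SAWCountZdShapeCensus.lean` (a-p1 g23: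
`shapeClass`-counting by `shUpd`/`shOk`/`shCls`, ★★★ `card_shapeClass_adjOf`), its keyed upgrade (U1) `SAWCountZdShapeCensusKeys.lean` (`shUpdK`/`shOkK`/`shClsK`,
★★★ `card_shapeClass_adjOf_keys`) and the weighted framework `SAWCountZdWeightedCensus.lean` (`dfsW`/`dfsVW`/`leafW`, ★★ `sum_TL_weight_eq_dfsW`, ★★ `dfsW_eq_of_table`,
the brute-force shape weight `wtSh`); the grouped counts `M_j(u,b) = Σ_{c : breaksN u c = b} #shapeClass_j(u, A_c)` feed `symbolPoly j` (`SAWCountZdFifthCoefficient.lean`)).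

PRINTED CONTEXT (locators only; nothing is quoted digit-for-digit). Madras–Slade (1993) Definition 1.2.4 (types / patterns of walks), §1.1 eq. (1.1.8) p. 5
(the `1/d` expansion of `μ`). The census machinery is the lane's; no number is taken from print.

WHY. At `j = 5` (`u ≤ 10`, `2^{u−1} = 512` adjacency classes, ≈ 30 000 reduced leaves, ≈ 2·10^5 search nodes) the class-indicator census and the brute-force weight
`wtSh` both exceed the kernel budget (a-p1 g23 calibration). Two facts make the census cheap: (i) the assembly only needs the counts GROUPED by the number of breaks
`b = u − |c|`, and (ii) at a leaf with reversal mask `rv` and zero-block masks `zm` the whole vector `(wt_b)_b` — `wt_b = #{c < 2^{u−1} : |c| = u − b, c ∩ rv = ∅,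
∃ z ∈ zm, z ⊆ c}` — is an inclusion–exclusion over the UP-SETS of the masks inside the free pairs `F = [0, u−1) ∖ rv`: with `X = B^{u+1}`,
`Σ_b wt_b X^b = X^{u − |F|} · Σ_{∅ ≠ S ⊆ Z_F} (−1)^{|S|+1} (X + 1)^{|F| − |⋃S|}` (`Z_F` = the masks inside `F`), evaluated by the recursion
`ie(z :: Z) = (X+1)^{|F|−|z|} + ie(Z) − ie(z ∪ Z)`. In the actual census `|Z_F| ≤ 4` at every leaf, so the leaf costs a handful of big-number operations.

THIS FILE. §1 `dfsVF` (the pruned search with an arbitrary LEAF VALUE `lf s m`), ★ `dfsVF_eq_dfsVW` (a leaf value equal to `leafW wt` gives the weighted census `dfsVW wt`),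
the TABLE-DRIVEN evaluation `dfsVT` (a-p3 g23's `fastAT` pattern of `SAWCountZdNoSingletonEngine`, made generic: sub-cell values read from a table of raw prefixes) with
★★ `dfsVT_eq` / `dfsVF_root_eq_dfsVT` (a true table gives the true value), `leafW_eq_sum`. §2 the fast leaf: `popB` (bits below `K`), `ieR` (the fuelled
inclusion–exclusion recursion), `freeM` (free-pair mask), ★ `fastWV` (the encoded weight vector from `(rv, zm)`), `fastLeafK` (on the keyed state), ★ `shVF u r B`
(THE FAST CENSUS VALUE: `dfsVF` on the keyed engine with key base `u + 1`), `wtShK` (the brute-force keyed weight = the MEANING of the fast leaf), `cellV` (the value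
below a raw prefix). §3 bit sets: `bits` (= Mathlib `bitIndices`), `mem_bits`, `sum_bits_two_pow` / `bits_sum_two_pow` (the bijection codes ↔ finite sets),
`lt_two_pow_iff_bits_subset`, `land_eq_self_iff_bits`, `land_eq_zero_iff_bits`, `bits_lor`, `popB_eq_card`, `bits_freeM`, `freeM_lt`, ★ `breaksN_eq_sub_card`
(`breaksN u c = u − #bits c` for `c < 2^{u−1}`). §4 `upsetSum` (the up-set sum `Σ_{T ⊆ F', ∃ z, bits z ⊆ T} X^{#F'−#T}`), ★ `sum_powerset_supset_eq`
(`Σ_{S ⊆ T ⊆ F'} X^{#F'−#T} = (X+1)^{#F'−#S}`, by `Finset.sum_pow_mul_eq_add_pow`), ★ `upG_cons` (two-set inclusion–exclusion: `G(z :: Z) + G(z ∪ Z) = (X+1)^{#F'−#z} + G(Z)`),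
`upG_nil`, ★★ `ieR_eq_upG` (the recursion IS the up-set sum), `wcnt` (the weight count), `sum_wcnt_eq_sum_codes`, and ★★★ `fastWV_eq_sum`: `fastWV u B rv zm m =
Σ_b wcnt u rv zm b · B^{(u+1) b + m}` for EVERY `rv`, `zm` (no reachability hypothesis). §5 `wtShK_eq_wcnt`, ★★ `fastLeafK_eq_leafW`, ★★ `shVF_eq_dfsVW` (the fast value
IS the weighted keyed census with weight `wtShK`), `wtShK_le`, `wtShK_eq_sum`, ★★★ `sum_card_shapeClass_eq_dfsW_keys` (the grouped shape counts as one weighted KEYED census,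
as `sum_card_shapeClass_eq_dfsW`), ★★★ `sum_card_shapeClass_eq_of_shVF` (THE READ-OFF: a fast cell `shVF u (u−j) B = table` gives `M_j(u,b) = 2^{u−j} · table[b][u−j]` for
all `b ≤ u`, when `2^{u−1}(2u)^u < B`), `shVF_eq_dfsVT` / ★ `shVF_eq_dfsVT_of_cells` (a fast cell from a table of TRUE sub-cells `cellV u r B w = v`). §6 SELF-TEST:
kernel cell `shVF_eight_four` (`u = 8`, `j = 4`, one `9 × 9`-digit evaluation, ≈ 10 s) and ★★ `sum_card_shapeClass_eight_four`: the grouped excess-four counts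
`M(8,·) = 16·(81, 213, 315, 216, 60)` of `SAWCountZdFifthCoefficient.shM_eq_lit`, re-derived by the fast route. The sequels certify the `j = 5` cells (`u ≤ 10`) and
assemble `symbolPoly 5`, making the sixth `1/d`-coefficient law (L1″) unconditional via `SAWCountZdSixthCoefficientReduction`.
The definitions `dfsVF`, `lookupW`, `dfsVT`, `popB`, `ieR`, `freeM`, `fastWV`, `fastLeafK`, `shVF`, `wtShK`, `cellV`, `bits`, `upsetSum`, `wcnt`, `fTab8` are this file's tool
notions (not notions in print); no number is taken from print (the self-test table is the kernel's own evaluation, equal to the landed census `shM_eq_lit`).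
[cite: MadrasSlade1993, Definition 1.2.4; §1.1 eq. (1.1.8) p. 5]

Provenance: lane «pcv-sawmu», a-p1 g24 (2026-08-27); design `HOME/pub-sawmu-a-p1/g23/eps5/DESIGN-next-car-epsilon5.md` (U2) (a-p1 g23).
-/

open Finset
open scoped BigOperators
open Literature.Probability.LatticeModels
open Literature.Probability.RandomPlanarGeometry.SAW
open Literature.Probability.Percolation

namespace Literature.Probability.RandomPlanarGeometry.SAW.Zd

namespace WordTypes

/-! ### §1 A depth-first census with an arbitrary leaf value, and its table-driven evaluation -/

section fdefs

variable {S : Type*} (alw : ℕ → ℕ × Bool → Bool) (upd : S → ℕ × Bool → S) (ok : S → Bool) (lf : S → ℕ → ℕ)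

/-- ★ The pruned depth-first census with an arbitrary LEAF VALUE `lf s m` (for the weighted census: the whole encoded weight vector of the leaf at once).
[cite: MadrasSlade1993, Definition 1.2.4; lane tool notion] -/
def dfsVF : ℕ → S → ℕ → ℕ
  | 0, s, m => if ok s then lf s m else 0
  | j + 1, s, m => if ok s then (lts alw m).foldr (fun a acc => acc + dfsVF j (upd s a) (nxt m a)) 0 else 0

/-- Lookup of a raw prefix in a cell table `(prefix, value)`. [cite: MadrasSlade1993, Definition 1.2.4; lane tool notion] -/
def lookupW (T : List (List (ℕ × Bool) × ℕ)) (w : List (ℕ × Bool)) : Option ℕ := (T.find? fun e => e.1 == w).map Prod.snd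

/-- ★ The TABLE-DRIVEN census: the same search from the root by raw prefixes, reading the value of any prefix found in the table `T` instead of searching
below it (so a census value can be certified in pieces). [cite: MadrasSlade1993, Definition 1.2.4; lane tool notion] -/
def dfsVT (T : List (List (ℕ × Bool) × ℕ)) (s₀ : S) : ℕ → List (ℕ × Bool) → ℕ → ℕ
  | 0, w, m => if ok (st upd s₀ w) then lf (st upd s₀ w) m else 0
  | j + 1, w, m =>
    match lookupW T w with
    | some v => v
    | none => if ok (st upd s₀ w) then (lts alw m).foldr (fun a acc => acc + dfsVT T s₀ j (w ++ [a]) (nxt m a)) 0 else 0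

/-- ★ A leaf value that IS an encoded weight vector gives the weighted census: `lf = leafW wt C N B ⇒ dfsVF lf = dfsVW wt C N B`.
[cite: MadrasSlade1993, Definition 1.2.4; lane lemma] -/
theorem dfsVF_eq_dfsVW (wt : ℕ → S → ℕ) (C N B : ℕ) (h : ∀ s m, lf s m = leafW wt C N B s m) :
    ∀ (j : ℕ) (s : S) (m : ℕ), dfsVF alw upd ok lf j s m = dfsVW alw upd ok wt C N B j s m := by
  intro j
  induction j with
  | zero => intro s m; unfold dfsVF dfsVW; rw [h]
  | succ j ih => intro s m; unfold dfsVF dfsVW; simp only [ih]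

/-- A successful lookup is a table entry. [cite: MadrasSlade1993, Definition 1.2.4; lane plumbing] -/
theorem mem_of_lookupW {T : List (List (ℕ × Bool) × ℕ)} {w : List (ℕ × Bool)} {v : ℕ} (h : lookupW T w = some v) : (w, v) ∈ T := by
  unfold lookupW at h
  obtain ⟨e, he, rfl⟩ := Option.map_eq_some_iff.1 h
  have h1 := List.find?_some he
  have h2 := List.mem_of_find?_eq_some he
  rw [beq_iff_eq] at h1
  rw [← h1]
  exact h2

/-- ★★ SOUNDNESS OF THE TABLE: if every entry `(w, v)` of `T` is TRUE — `dfsVF … (L − |w|) (st w) (naxL 0 w) = v` with `|w| ≤ L` — then the table-driven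
value from any prefix is the true value. [cite: MadrasSlade1993, Definition 1.2.4; lane lemma] -/
theorem dfsVT_eq (T : List (List (ℕ × Bool) × ℕ)) (s₀ : S) (L : ℕ)
    (hT : ∀ e ∈ T, e.1.length ≤ L ∧ dfsVF alw upd ok lf (L - e.1.length) (st upd s₀ e.1) (naxL 0 e.1) = e.2) :
    ∀ (j : ℕ) (w : List (ℕ × Bool)), w.length + j = L → dfsVT alw upd ok lf T s₀ j w (naxL 0 w) = dfsVF alw upd ok lf j (st upd s₀ w) (naxL 0 w) := by
  intro j
  induction j with
  | zero => intro w _; rfl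
  | succ j ih =>
    intro w hw
    rw [dfsVT]
    cases hl : lookupW T w with
    | some v =>
      simp only
      obtain ⟨-, h2⟩ := hT _ (mem_of_lookupW hl)
      simp only at h2
      rw [show L - w.length = j + 1 by omega] at h2
      exact h2.symm
    | none =>
      simp only
      rw [dfsVF]
      by_cases hok : ok (st upd s₀ w) = true
      · rw [if_pos hok, if_pos hok]
        refine foldr_add_congr _ _ _ fun a _ => ?_
        rw [← naxL_append_singleton, ih (w ++ [a]) (by simp; omega), st_append_singleton, naxL_append_singleton]
      · rw [if_neg hok, if_neg hok]

/-- ★ THE ROOT VALUE FROM A TRUE TABLE. [cite: MadrasSlade1993, Definition 1.2.4; lane lemma] -/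
theorem dfsVF_root_eq_dfsVT (T : List (List (ℕ × Bool) × ℕ)) (s₀ : S) (L : ℕ)
    (hT : ∀ e ∈ T, e.1.length ≤ L ∧ dfsVF alw upd ok lf (L - e.1.length) (st upd s₀ e.1) (naxL 0 e.1) = e.2) :
    dfsVF alw upd ok lf L s₀ 0 = dfsVT alw upd ok lf T s₀ L [] 0 := by
  have h := dfsVT_eq alw upd ok lf T s₀ L hT L [] (by simp)
  exact h.symm

/-- The leaf value `leafW` as a finite sum. [cite: MadrasSlade1993, Definition 1.2.4; lane plumbing] -/
theorem leafW_eq_sum (wt : ℕ → S → ℕ) (C N B : ℕ) (s : S) (m : ℕ) :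
    leafW wt C N B s m = ∑ b ∈ Finset.range C, wt b s * B ^ (N * b + m) := by
  unfold leafW
  rw [foldr_add_eq_sum, sum_map_range]

end fdefs

/-! ### §2 The fast leaf: the encoded weight vector by inclusion–exclusion over the zero-block masks -/

section fastdefs

/-- The number of set bits below `K`. [cite: MadrasSlade1993, Definition 1.2.4; lane tool notion] -/
def popB (K c : ℕ) : ℕ := ((List.range K).filter fun k => c.testBit k).length

/-- Inclusion–exclusion over the up-sets of the masks `Z` (fuel `n`): `Σ_{∅ ≠ S ⊆ Z} (−1)^{|S|+1} Y^(p − pop (⋃ S))`, evaluated as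
`ie(z :: Z) = Y^(p − pop z) + ie(Z) − ie(z ∪ Z)`. [cite: MadrasSlade1993, Definition 1.2.4; lane tool notion] -/
def ieR (K Y p : ℕ) : ℕ → List ℕ → ℕ
  | 0, _ => 0
  | _ + 1, [] => 0
  | n + 1, z :: Z => (Y ^ (p - popB K z) + ieR K Y p n Z) - ieR K Y p n (Z.map (z ||| ·))

/-- The free-pair mask: bits `< K` not in the reversal mask `rv`. [cite: MadrasSlade1993, Definition 1.2.4; lane tool notion] -/
def freeM (K rv : ℕ) : ℕ := (2 ^ K - 1) &&& ((2 ^ K - 1) ^^^ rv)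

/-- ★ THE FAST LEAF VALUE from the reversal mask `rv` and the zero-block masks `zm` of a word of length `u` with `m` axes: the encoded weight vector
`Σ_b wt_b · B^((u+1) b + m)`, `wt_b` = the number of adjacency codes `c < 2^(u−1)` with `u − pop c = b` breaks, `c ∩ rv = ∅` and `z ⊆ c` for some `z ∈ zm`
— computed as `B^m · X^(u − |F|) · ie(Z_F)` with `X = B^(u+1)`, `F` the free pairs and `Z_F` the masks inside `F`. [cite: MadrasSlade1993, Definition 1.2.4; lane tool notion] -/
def fastWV (u B rv : ℕ) (zm : List ℕ) (m : ℕ) : ℕ :=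
  match zm.filter fun z => z &&& freeM (u - 1) rv == z with
  | [] => 0
  | z :: Z => B ^ m * ((B ^ (u + 1)) ^ (u - popB (u - 1) (freeM (u - 1) rv)) *
      ieR (u - 1) (B ^ (u + 1) + 1) (popB (u - 1) (freeM (u - 1) rv)) (Z.length + 1) (z :: Z))

/-- The fast leaf on the keyed search state. [cite: MadrasSlade1993, Definition 1.2.4; lane tool notion] -/
def fastLeafK (u B : ℕ) (s : ShStK) (m : ℕ) : ℕ := fastWV u B s.rv s.zm m

/-- ★ THE FAST CENSUS VALUE for word length `u`, `r` axes, base `B` (keyed engine, key base `u + 1`, reduced search).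
[cite: MadrasSlade1993, Definition 1.2.4; lane tool notion] -/
def shVF (u r B : ℕ) : ℕ := dfsVF alwR (shUpdK (u + 1)) (shOkK u r) (fastLeafK u B) u shS0K 0

/-- The keyed shape WEIGHT of break count `b`: adjacency codes `c < 2^(u−1)` with `breaksN u c = b` passing `shClsK c` (brute force; the meaning of the
fast leaf). [cite: MadrasSlade1993, Definition 1.2.4; lane tool notion] -/
def wtShK (u : ℕ) (b : ℕ) (s : ShStK) : ℕ := ((List.range (2 ^ (u - 1))).filter fun c => breaksN u c == b && shClsK c s).length

/-- The fast census value BELOW THE RAW PREFIX `w` (a sub-cell: the rest of the word searched from the keyed state of `w`).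
[cite: MadrasSlade1993, Definition 1.2.4; lane tool notion] -/
def cellV (u r B : ℕ) (w : List (ℕ × Bool)) : ℕ :=
  dfsVF alwR (shUpdK (u + 1)) (shOkK u r) (fastLeafK u B) (u - w.length) (st (shUpdK (u + 1)) shS0K w) (naxL 0 w)

end fastdefs

/-! ### §3 Bit sets of masks -/

section bits

/-- The set of bit positions of a natural number (Mathlib's `bitIndices`). [cite: MadrasSlade1993, Definition 1.2.4; lane plumbing] -/
def bits (c : ℕ) : Finset ℕ := c.bitIndices.toFinset

/-- Membership in `bits`. [cite: MadrasSlade1993, Definition 1.2.4; lane plumbing] -/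
theorem mem_bits {c k : ℕ} : k ∈ bits c ↔ c.testBit k = true := by
  unfold bits; rw [List.mem_toFinset, Nat.mem_bitIndices]

/-- `bits` inverts the binary expansion. [cite: MadrasSlade1993, Definition 1.2.4; lane plumbing] -/
theorem sum_bits_two_pow (c : ℕ) : ∑ k ∈ bits c, 2 ^ k = c := Finset.sum_toFinset_bitIndices_two_pow c

/-- The binary expansion inverts `bits`. [cite: MadrasSlade1993, Definition 1.2.4; lane plumbing] -/
theorem bits_sum_two_pow (T : Finset ℕ) : bits (∑ k ∈ T, 2 ^ k) = T := Finset.toFinset_bitIndices_sum_two_pow T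

/-- `c < 2^K` iff all bits are below `K`. [cite: MadrasSlade1993, Definition 1.2.4; lane plumbing] -/
theorem lt_two_pow_iff_bits_subset (c K : ℕ) : c < 2 ^ K ↔ bits c ⊆ Finset.range K := by
  constructor
  · intro h k hk
    rw [mem_bits] at hk
    rw [Finset.mem_range]
    by_contra hh
    have : c.testBit k = false := Nat.testBit_lt_two_pow (lt_of_lt_of_le h (Nat.pow_le_pow_right (by norm_num) (not_lt.1 hh)))
    rw [this] at hk; exact Bool.false_ne_true hk
  · intro h
    apply Nat.lt_pow_two_of_testBit
    intro i hi
    by_contra hh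
    have hmem : i ∈ bits c := mem_bits.2 (by simpa using hh)
    have := Finset.mem_range.1 (h hmem)
    omega

/-- Sub-mask ⇔ subset of bits. [cite: MadrasSlade1993, Definition 1.2.4; lane plumbing] -/
theorem land_eq_self_iff_bits (z c : ℕ) : z &&& c = z ↔ bits z ⊆ bits c := by
  rw [land_eq_self_iff]
  simp only [Finset.subset_iff, mem_bits]

/-- Disjoint masks ⇔ disjoint bits. [cite: MadrasSlade1993, Definition 1.2.4; lane plumbing] -/
theorem land_eq_zero_iff_bits (c m : ℕ) : c &&& m = 0 ↔ Disjoint (bits c) (bits m) := by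
  rw [land_eq_zero_iff', Finset.disjoint_left]
  simp only [mem_bits, not_and]

/-- Bits of a union of masks. [cite: MadrasSlade1993, Definition 1.2.4; lane plumbing] -/
theorem bits_lor (z z' : ℕ) : bits (z ||| z') = bits z ∪ bits z' := by
  ext k
  rw [Finset.mem_union, mem_bits, mem_bits, mem_bits, Nat.testBit_lor, Bool.or_eq_true]

/-- `popB K c` is the number of bits when `c < 2^K`. [cite: MadrasSlade1993, Definition 1.2.4; lane plumbing] -/
theorem popB_eq_card {K c : ℕ} (h : c < 2 ^ K) : popB K c = (bits c).card := by
  unfold popB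
  rw [← List.toFinset_card_of_nodup ((List.nodup_range).filter _), List.toFinset_filter, List.toFinset_range]
  congr 1
  ext k
  rw [Finset.mem_filter, Finset.mem_range, mem_bits]
  constructor
  · rintro ⟨-, hk⟩; exact hk
  · intro hk; exact ⟨Finset.mem_range.1 ((lt_two_pow_iff_bits_subset c K).1 h (mem_bits.2 hk)), hk⟩

/-- The bits of the free-pair mask: positions `< K` outside the reversal mask. [cite: MadrasSlade1993, Definition 1.2.4; lane plumbing] -/
theorem bits_freeM (K rv : ℕ) : bits (freeM K rv) = Finset.range K \ bits rv := by
  ext k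
  rw [mem_bits, Finset.mem_sdiff, Finset.mem_range, mem_bits]
  unfold freeM
  rw [Nat.testBit_land, Nat.testBit_xor, Nat.testBit_two_pow_sub_one]
  by_cases hk : k < K
  · simp only [hk, decide_true, Bool.true_and]
    cases rv.testBit k <;> simp
  · simp [hk]

/-- The free-pair mask is below `2^K`. [cite: MadrasSlade1993, Definition 1.2.4; lane plumbing] -/
theorem freeM_lt (K rv : ℕ) : freeM K rv < 2 ^ K := by
  rw [lt_two_pow_iff_bits_subset, bits_freeM]
  exact Finset.sdiff_subset

/-- ★ `breaksN u c = u − #bits c` whenever `c < 2^(u−1)` (every set bit is a non-break among the `u` positions).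
[cite: MadrasSlade1993, Definition 1.2.4; lane lemma] -/
theorem breaksN_eq_sub_card {u c : ℕ} (hc : c < 2 ^ (u - 1)) : breaksN u c = u - (bits c).card := by
  have hsub := (lt_two_pow_iff_bits_subset c (u - 1)).1 hc
  unfold breaksN
  rw [← List.toFinset_card_of_nodup ((List.nodup_range).filter _), List.toFinset_filter, List.toFinset_range]
  have hset : (Finset.range u).filter (fun k => (!(decide (k + 1 < u) && c.testBit k)) = true) = Finset.range u \ bits c := by
    ext k
    rw [Finset.mem_filter, Finset.mem_sdiff, Finset.mem_range, mem_bits]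
    constructor
    · rintro ⟨hk, h⟩
      refine ⟨hk, fun hb => ?_⟩
      have hk1 : k + 1 < u := by have := Finset.mem_range.1 (hsub (mem_bits.2 hb)); omega
      simp [hk1, hb] at h
    · rintro ⟨hk, h⟩
      refine ⟨hk, ?_⟩
      cases hb : c.testBit k
      · simp
      · exact absurd hb h
  rw [hset, Finset.card_sdiff_of_subset (hsub.trans (Finset.range_subset_range.2 (Nat.sub_le u 1))), Finset.card_range]

end bits

/-! ### §4 Inclusion–exclusion over up-sets, and the fast leaf IS the encoded weight vector -/

section ie

open Classical in
/-- The UP-SET SUM of the masks `Z` inside `F'`: over the subsets `T ⊆ F'` containing the bits of some `z ∈ Z`, `Σ X^(#F' − #T)`.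
[cite: MadrasSlade1993, Definition 1.2.4; lane tool notion] -/
noncomputable def upsetSum (X : ℕ) (F' : Finset ℕ) (Z : List ℕ) : ℕ :=
  ∑ T ∈ F'.powerset.filter (fun T => ∃ z ∈ Z, bits z ⊆ T), X ^ (F'.card - T.card)

open Classical in
/-- ★ THE BINOMIAL IDENTITY FOR ONE UP-SET: `Σ_{S ⊆ T ⊆ F'} X^(#F' − #T) = (X + 1)^(#F' − #S)`. [cite: MadrasSlade1993, Definition 1.2.4; lane lemma] -/
theorem sum_powerset_supset_eq (X : ℕ) (F' S : Finset ℕ) (hS : S ⊆ F') :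
    ∑ T ∈ F'.powerset.filter (fun T => S ⊆ T), X ^ (F'.card - T.card) = (X + 1) ^ (F'.card - S.card) := by
  have h := Finset.sum_pow_mul_eq_add_pow 1 X (F' \ S)
  simp only [one_pow, one_mul] at h
  rw [Finset.card_sdiff_of_subset hS, add_comm 1 X] at h
  rw [← h]
  refine Finset.sum_nbij' (· \ S) (· ∪ S) ?_ ?_ ?_ ?_ ?_
  · intro T hT
    rw [Finset.mem_filter, Finset.mem_powerset] at hT
    rw [Finset.mem_powerset]
    exact Finset.sdiff_subset_sdiff hT.1 (le_refl S)
  · intro T' hT'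
    rw [Finset.mem_powerset] at hT'
    rw [Finset.mem_filter, Finset.mem_powerset]
    exact ⟨Finset.union_subset (hT'.trans Finset.sdiff_subset) hS, Finset.subset_union_right⟩
  · intro T hT
    rw [Finset.mem_filter] at hT
    exact Finset.sdiff_union_of_subset hT.2
  · intro T' hT'
    rw [Finset.mem_powerset] at hT'
    exact Finset.union_sdiff_cancel_right (Finset.disjoint_of_subset_left hT' Finset.sdiff_disjoint)
  · intro T hT
    rw [Finset.mem_filter, Finset.mem_powerset] at hT
    rw [Finset.card_sdiff_of_subset hT.2]
    have h1 := Finset.card_le_card hT.1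
    have h2 := Finset.card_le_card hT.2
    congr 1
    omega

open Classical in
/-- ★ TWO-SET INCLUSION–EXCLUSION FOR UP-SETS: `G(z :: Z) + G(z ∪ Z) = (X+1)^(#F' − #z) + G(Z)` (the up-set of `z` meets the union of the up-sets of `Z`
in the union of the up-sets of the `z ∪ z'`). [cite: MadrasSlade1993, Definition 1.2.4; lane lemma] -/
theorem upG_cons (X : ℕ) (F' : Finset ℕ) (z : ℕ) (Z : List ℕ) (hz : bits z ⊆ F') :
    upsetSum X F' (z :: Z) + upsetSum X F' (Z.map (z ||| ·)) = (X + 1) ^ (F'.card - (bits z).card) + upsetSum X F' Z := by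
  unfold upsetSum
  have hU : F'.powerset.filter (fun T => ∃ w ∈ z :: Z, bits w ⊆ T) =
      F'.powerset.filter (fun T => bits z ⊆ T) ∪ F'.powerset.filter (fun T => ∃ w ∈ Z, bits w ⊆ T) := by
    ext T
    simp only [Finset.mem_filter, Finset.mem_union, List.mem_cons, exists_eq_or_imp]
    tauto
  have hI : F'.powerset.filter (fun T => ∃ w ∈ Z.map (z ||| ·), bits w ⊆ T) =
      F'.powerset.filter (fun T => bits z ⊆ T) ∩ F'.powerset.filter (fun T => ∃ w ∈ Z, bits w ⊆ T) := by
    ext T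
    simp only [Finset.mem_filter, Finset.mem_inter, List.mem_map]
    constructor
    · rintro ⟨hT, w, ⟨z', hz', rfl⟩, hw⟩
      rw [bits_lor, Finset.union_subset_iff] at hw
      exact ⟨⟨hT, hw.1⟩, hT, z', hz', hw.2⟩
    · rintro ⟨⟨hT, h1⟩, -, z', hz', h2⟩
      exact ⟨hT, z ||| z', ⟨z', hz', rfl⟩, by rw [bits_lor]; exact Finset.union_subset h1 h2⟩
  rw [hU, hI, Finset.sum_union_inter, sum_powerset_supset_eq X F' (bits z) hz]

open Classical in
/-- The empty family has no up-set. [cite: MadrasSlade1993, Definition 1.2.4; lane plumbing] -/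
theorem upG_nil (X : ℕ) (F' : Finset ℕ) : upsetSum X F' [] = 0 := by
  unfold upsetSum
  rw [Finset.sum_eq_zero]
  intro T hT
  rw [Finset.mem_filter] at hT
  obtain ⟨-, z, hz, -⟩ := hT
  simp at hz

open Classical in
/-- ★★ THE INCLUSION–EXCLUSION EVALUATOR IS THE UP-SET SUM: for masks inside `F' ⊆ [0, K)` and enough fuel,
`ieR K (X+1) #F' n Z = G(Z)`. [cite: MadrasSlade1993, Definition 1.2.4; lane lemma] -/
theorem ieR_eq_upG (K X : ℕ) (F' : Finset ℕ) (hF : F' ⊆ Finset.range K) :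
    ∀ (n : ℕ) (Z : List ℕ), Z.length ≤ n → (∀ z ∈ Z, bits z ⊆ F') → ieR K (X + 1) F'.card n Z = upsetSum X F' Z := by
  intro n
  induction n with
  | zero =>
    intro Z hZ _
    have : Z = [] := List.eq_nil_of_length_eq_zero (by omega)
    subst this
    rw [upG_nil]; rfl
  | succ n ih =>
    intro Z hZ hm
    cases Z with
    | nil => rw [upG_nil]; rfl
    | cons z Z =>
      have hz : bits z ⊆ F' := hm z (by simp)
      have hzl : z < 2 ^ K := (lt_two_pow_iff_bits_subset z K).2 (hz.trans hF)
      have h1 := ih Z (by simp at hZ; omega) (fun w hw => hm w (by simp [hw]))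
      have h2 := ih (Z.map (z ||| ·)) (by simp at hZ ⊢; omega) (by
        intro w hw
        obtain ⟨z', hz', rfl⟩ := List.mem_map.1 hw
        rw [bits_lor]
        exact Finset.union_subset hz (hm z' (by simp [hz'])))
      rw [ieR, h1, h2, popB_eq_card hzl]
      have := upG_cons X F' z Z hz
      omega

open Classical in
/-- The WEIGHT COUNT the fast leaf encodes: adjacency codes `c < 2^(u−1)` with `breaksN u c = b`, disjoint from `rv`, containing some mask of `zm`.
[cite: MadrasSlade1993, Definition 1.2.4; lane tool notion] -/
noncomputable def wcnt (u rv : ℕ) (zm : List ℕ) (b : ℕ) : ℕ :=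
  ((Finset.range (2 ^ (u - 1))).filter fun c => breaksN u c = b ∧ c &&& rv = 0 ∧ ∃ z ∈ zm, z &&& c = z).card

open Classical in
/-- Regrouping the encoded weight vector by code: `Σ_b wcnt_b · B^((u+1) b + m) = Σ_{c admissible} B^((u+1)·breaksN u c + m)`.
[cite: MadrasSlade1993, Definition 1.2.4; lane plumbing] -/
theorem sum_wcnt_eq_sum_codes (u B rv : ℕ) (zm : List ℕ) (m : ℕ) :
    ∑ b ∈ Finset.range (u + 1), wcnt u rv zm b * B ^ ((u + 1) * b + m) =
      ∑ c ∈ (Finset.range (2 ^ (u - 1))).filter (fun c => c &&& rv = 0 ∧ ∃ z ∈ zm, z &&& c = z), B ^ ((u + 1) * breaksN u c + m) := by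
  unfold wcnt
  simp only [Finset.card_filter, Finset.sum_mul]
  rw [Finset.sum_comm, Finset.sum_filter]
  refine Finset.sum_congr rfl fun c _ => ?_
  by_cases hc : c &&& rv = 0 ∧ ∃ z ∈ zm, z &&& c = z
  · rw [if_pos hc]
    have hmem : breaksN u c ∈ Finset.range (u + 1) := Finset.mem_range.2 (Nat.lt_succ_of_le (breaksN_le u c))
    rw [Finset.sum_eq_single_of_mem (breaksN u c) hmem]
    · rw [if_pos ⟨rfl, hc⟩, one_mul]
    · intro b _ hb; rw [if_neg (fun h => hb h.1.symm), zero_mul]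
  · rw [if_neg hc]
    refine Finset.sum_eq_zero fun b _ => ?_
    rw [if_neg fun h => hc h.2, zero_mul]

open Classical in
/-- ★★★ THE FAST LEAF IS THE ENCODED WEIGHT VECTOR: `fastWV u B rv zm m = Σ_b wcnt u rv zm b · B^((u+1) b + m)` — for EVERY reversal mask `rv` and EVERY list
of masks `zm` (no reachability hypothesis). [cite: MadrasSlade1993, Definition 1.2.4; lane theorem] -/
theorem fastWV_eq_sum (u B rv : ℕ) (zm : List ℕ) (m : ℕ) :
    fastWV u B rv zm m = ∑ b ∈ Finset.range (u + 1), wcnt u rv zm b * B ^ ((u + 1) * b + m) := by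
  rw [sum_wcnt_eq_sum_codes]
  set K := u - 1 with hK
  set F := freeM K rv with hFdef
  set F' := bits F with hF'
  set X := B ^ (u + 1) with hX
  have hF'eq : F' = Finset.range K \ bits rv := by rw [hF', hFdef, bits_freeM]
  have hF'sub : F' ⊆ Finset.range K := by rw [hF'eq]; exact Finset.sdiff_subset
  have hcardF' : F'.card ≤ u := (Finset.card_le_card hF'sub).trans (by rw [Finset.card_range]; omega)
  have hFlt : F < 2 ^ K := freeM_lt K rv
  -- Step 2: codes ↦ bit sets
  have hstep2 : ∑ c ∈ (Finset.range (2 ^ K)).filter (fun c => c &&& rv = 0 ∧ ∃ z ∈ zm, z &&& c = z), B ^ ((u + 1) * breaksN u c + m) =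
      ∑ T ∈ F'.powerset.filter (fun T => ∃ z ∈ zm.filter (fun z => z &&& F == z), bits z ⊆ T), B ^ ((u + 1) * (u - T.card) + m) := by
    refine Finset.sum_nbij' bits (fun T => ∑ k ∈ T, 2 ^ k) ?_ ?_ ?_ ?_ ?_
    · intro c hc
      rw [Finset.mem_filter, Finset.mem_range] at hc
      obtain ⟨hcK, hrv, z, hz, hzc⟩ := hc
      have hcsub : bits c ⊆ F' := by
        rw [hF'eq, Finset.subset_sdiff]
        exact ⟨(lt_two_pow_iff_bits_subset c K).1 hcK, (land_eq_zero_iff_bits c rv).1 hrv⟩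
      rw [Finset.mem_filter, Finset.mem_powerset]
      refine ⟨hcsub, z, ?_, (land_eq_self_iff_bits z c).1 hzc⟩
      rw [List.mem_filter, beq_iff_eq, land_eq_self_iff_bits]
      exact ⟨hz, ((land_eq_self_iff_bits z c).1 hzc).trans hcsub⟩
    · intro T hT
      rw [Finset.mem_filter, Finset.mem_powerset] at hT
      obtain ⟨hT, z, hz, hzT⟩ := hT
      rw [List.mem_filter] at hz
      rw [Finset.mem_filter, Finset.mem_range, lt_two_pow_iff_bits_subset, bits_sum_two_pow, land_eq_zero_iff_bits, bits_sum_two_pow]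
      have hT' := hT
      rw [hF'eq, Finset.subset_sdiff] at hT'
      exact ⟨hT'.1, hT'.2, z, hz.1, by rw [land_eq_self_iff_bits, bits_sum_two_pow]; exact hzT⟩
    · intro c _; exact sum_bits_two_pow c
    · intro T _; exact bits_sum_two_pow T
    · intro c hc
      rw [Finset.mem_filter, Finset.mem_range] at hc
      rw [breaksN_eq_sub_card hc.1]
  rw [hstep2]
  -- Step 4: pull out `B^m · X^(u − #F')`
  have hstep4 : ∑ T ∈ F'.powerset.filter (fun T => ∃ z ∈ zm.filter (fun z => z &&& F == z), bits z ⊆ T), B ^ ((u + 1) * (u - T.card) + m) =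
      B ^ m * (X ^ (u - F'.card) * upsetSum X F' (zm.filter fun z => z &&& F == z)) := by
    unfold upsetSum
    rw [Finset.mul_sum, Finset.mul_sum]
    refine Finset.sum_congr rfl fun T hT => ?_
    rw [Finset.mem_filter, Finset.mem_powerset] at hT
    have hTc : T.card ≤ F'.card := Finset.card_le_card hT.1
    rw [hX, ← pow_mul, ← pow_mul, ← pow_add, ← pow_add]
    congr 1
    have : u - T.card = (u - F'.card) + (F'.card - T.card) := by omega
    rw [this]
    ring
  rw [hstep4]
  -- Step 5: the evaluator
  have hmasks : ∀ w ∈ zm.filter (fun z => z &&& F == z), bits w ⊆ F' := by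
    intro w hw
    rw [List.mem_filter, beq_iff_eq, land_eq_self_iff_bits] at hw
    exact hw.2
  unfold fastWV
  split
  · rename_i h
    rw [← hK, ← hFdef] at h
    rw [h, upG_nil, mul_zero, mul_zero]
  · rename_i z Z h
    rw [← hK, ← hFdef] at h
    rw [h, ← hX, popB_eq_card hFlt, ← hF']
    congr 2
    rw [h] at hmasks
    exact ieR_eq_upG K X F' hF'sub (Z.length + 1) (z :: Z) (by simp) hmasks

end ie

/-! ### §5 The fast census IS the weighted census of the keyed engine; grouped shape counts read off a fast cell -/

section readoff

open Classical in
/-- The brute-force keyed weight is the count the fast leaf encodes. [cite: MadrasSlade1993, Definition 1.2.4; lane plumbing] -/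
theorem wtShK_eq_wcnt (u b : ℕ) (s : ShStK) : wtShK u b s = wcnt u s.rv s.zm b := by
  unfold wtShK wcnt
  rw [← List.toFinset_card_of_nodup ((List.nodup_range).filter _), List.toFinset_filter, List.toFinset_range]
  congr 1
  refine Finset.filter_congr fun c _ => ?_
  unfold shClsK
  rw [Bool.and_eq_true, Bool.and_eq_true, beq_iff_eq, beq_iff_eq, List.any_eq_true]
  simp only [beq_iff_eq]

/-- ★★ THE FAST LEAF IS `leafW` OF THE KEYED SHAPE WEIGHT: `fastLeafK u B s m = leafW (wtShK u) (u+1) (u+1) B s m` for every keyed state.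
[cite: MadrasSlade1993, Definition 1.2.4; lane theorem] -/
theorem fastLeafK_eq_leafW (u B : ℕ) (s : ShStK) (m : ℕ) : fastLeafK u B s m = leafW (wtShK u) (u + 1) (u + 1) B s m := by
  unfold fastLeafK
  rw [fastWV_eq_sum, leafW_eq_sum]
  simp only [wtShK_eq_wcnt]

/-- ★★ THE FAST CENSUS VALUE IS THE WEIGHTED CENSUS VALUE of the keyed engine with the brute-force shape weight.
[cite: MadrasSlade1993, Definition 1.2.4; lane theorem] -/
theorem shVF_eq_dfsVW (u r B : ℕ) :
    shVF u r B = dfsVW alwR (shUpdK (u + 1)) (shOkK u r) (wtShK u) (u + 1) (u + 1) B u shS0K 0 := by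
  unfold shVF
  exact dfsVF_eq_dfsVW alwR (shUpdK (u + 1)) (shOkK u r) (fastLeafK u B) (wtShK u) (u + 1) (u + 1) B (fastLeafK_eq_leafW u B) u shS0K 0

/-- The keyed shape weight is at most `2^(u−1)`. [cite: MadrasSlade1993, Definition 1.2.4; lane plumbing] -/
theorem wtShK_le (u b : ℕ) (s : ShStK) : wtShK u b s ≤ 2 ^ (u - 1) := by
  unfold wtShK
  exact (List.length_filter_le _ _).trans (by simp)

/-- The keyed shape weight as a finite sum of class indicators. [cite: MadrasSlade1993, Definition 1.2.4; lane plumbing] -/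
theorem wtShK_eq_sum (u b : ℕ) (s : ShStK) :
    wtShK u b s = ∑ c ∈ Finset.range (2 ^ (u - 1)), (if breaksN u c = b ∧ shClsK c s = true then 1 else 0) := by
  unfold wtShK
  rw [← List.countP_eq_length_filter, countP_eq_sum_map_ite, sum_map_range]
  refine Finset.sum_congr rfl fun c _ => ?_
  simp only [Bool.and_eq_true, beq_iff_eq]

open Classical in
/-- ★★★ THE GROUPED SHAPE COUNTS AS ONE WEIGHTED KEYED CENSUS: for `j ≤ u < W`,
`Σ_{c < 2^{u−1}, breaksN u c = b} #shapeClass_j(u, A_c) = 2^{u−j} · dfsW alwR (shUpdK W) (shOkK u (u−j)) (wtShK u) b (u−j) u shS0K 0`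
(as `sum_card_shapeClass_eq_dfsW`, on the keyed count theorem `card_shapeClass_adjOf_keys`). [cite: MadrasSlade1993, Definition 1.2.4; §1.1 eq. (1.1.8) p. 5; lane theorem] -/
theorem sum_card_shapeClass_eq_dfsW_keys (j u b W : ℕ) (hju : j ≤ u) (hW : u < W) :
    ∑ c ∈ Finset.range (2 ^ (u - 1)), (if breaksN u c = b then (shapeClass j u (adjOf u c)).card else 0) =
      2 ^ (u - j) * dfsW alwR (shUpdK W) (shOkK u (u - j)) (wtShK u) b (u - j) u shS0K 0 := by
  set T := (TL u).filter fun τ => rgA alwR 0 (rawW τ) = true ∧ PrefixOK (shUpdK W) (shOkK u (u - j)) shS0K τ ∧ numAxes τ = u - j with hT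
  have hclass : ∀ c, (shapeClass j u (adjOf u c)).card =
      2 ^ (u - j) * ∑ τ ∈ T, (if shClsK c (st (shUpdK W) shS0K (rawW τ)) = true then 1 else 0) := by
    intro c
    rw [card_shapeClass_adjOf_keys j u c W hju hW, ← card_TL_class alwR (shUpdK W) (shOkK u (u - j)) shClsK shS0K c (u - j),
      ← Finset.card_filter, hT, Finset.filter_filter, Finset.filter_filter]
    congr 2
    exact Finset.filter_congr fun τ _ => by tauto
  have hlhs : ∀ c ∈ Finset.range (2 ^ (u - 1)), (if breaksN u c = b then (shapeClass j u (adjOf u c)).card else 0) =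
      2 ^ (u - j) * ∑ τ ∈ T, (if breaksN u c = b ∧ shClsK c (st (shUpdK W) shS0K (rawW τ)) = true then 1 else 0) := by
    intro c _
    rw [hclass c]
    by_cases hb : breaksN u c = b
    · rw [if_pos hb]
      congr 1
      refine Finset.sum_congr rfl fun τ _ => ?_
      by_cases hc : shClsK c (st (shUpdK W) shS0K (rawW τ)) = true
      · rw [if_pos hc, if_pos ⟨hb, hc⟩]
      · rw [if_neg hc, if_neg fun h => hc h.2]
    · rw [if_neg hb, eq_comm, Nat.mul_eq_zero]
      right
      exact Finset.sum_eq_zero fun τ _ => by rw [if_neg fun h => hb h.1]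
  rw [Finset.sum_congr rfl hlhs, ← Finset.mul_sum, Finset.sum_comm,
    ← sum_TL_weight_eq_dfsW alwR (shUpdK W) (shOkK u (u - j)) (wtShK u) shS0K b (u - j), ← hT]
  congr 1
  exact Finset.sum_congr rfl fun τ _ => (wtShK_eq_sum u b _).symm

open Classical in
/-- ★★★ THE GROUPED SHAPE COUNTS READ OFF A FAST CELL: if the fast census value `shVF u (u − j) B` is the base-`B` table `tab` (`u + 1` rows = break counts,
`u + 1` columns = axis counts, entries `< B`) with `2^(u−1)·(2u)^u < B`, then for every `b ≤ u`
`Σ_{c < 2^{u−1}, breaksN u c = b} #shapeClass_j(u, A_c) = 2^{u−j} · tab[b][u − j]`. [cite: MadrasSlade1993, Definition 1.2.4; §1.1 eq. (1.1.8) p. 5; lane theorem] -/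
theorem sum_card_shapeClass_eq_of_shVF (j u B : ℕ) (hju : j ≤ u) (hB : 2 ^ (u - 1) * (2 * u) ^ u < B) (tab : List (List ℕ))
    (hC : tab.length = u + 1) (hlen : ∀ r ∈ tab, r.length = u + 1) (hlt : ∀ r ∈ tab, ∀ x ∈ r, x < B)
    (hV : shVF u (u - j) B = Nat.ofDigits (B ^ (u + 1)) (tab.map (Nat.ofDigits B))) (b : ℕ) (hb : b ≤ u) :
    ∑ c ∈ Finset.range (2 ^ (u - 1)), (if breaksN u c = b then (shapeClass j u (adjOf u c)).card else 0) =
      2 ^ (u - j) * ((tab.getD b []).getD (u - j) 0) := by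
  rw [sum_card_shapeClass_eq_dfsW_keys j u b (u + 1) hju (Nat.lt_succ_self u)]
  rw [shVF_eq_dfsVW] at hV
  rw [dfsW_eq_of_table alwR (shUpdK (u + 1)) (shOkK u (u - j)) (wtShK u) (C := u + 1) (L := u) (B := B) (W := 2 ^ (u - 1)) shS0K
    (wtShK_le u) hB tab hC hlen hlt hV (Nat.lt_succ_of_le hb) (Nat.sub_le u j)]

/-- ★ THE FAST CENSUS VALUE FROM A TRUE CELL TABLE (for certifying a large cell in pieces): if every entry `(w, v)` of `T` satisfies
`dfsVF … (u − |w|) (st w) (naxL 0 w) = v` with `|w| ≤ u`, then `shVF u r B = dfsVT … T shS0K u [] 0`. [cite: MadrasSlade1993, Definition 1.2.4; lane lemma] -/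
theorem shVF_eq_dfsVT (u r B : ℕ) (T : List (List (ℕ × Bool) × ℕ))
    (hT : ∀ e ∈ T, e.1.length ≤ u ∧
      dfsVF alwR (shUpdK (u + 1)) (shOkK u r) (fastLeafK u B) (u - e.1.length) (st (shUpdK (u + 1)) shS0K e.1) (naxL 0 e.1) = e.2) :
    shVF u r B = dfsVT alwR (shUpdK (u + 1)) (shOkK u r) (fastLeafK u B) T shS0K u [] 0 :=
  dfsVF_root_eq_dfsVT alwR (shUpdK (u + 1)) (shOkK u r) (fastLeafK u B) T shS0K u hT

/-- ★ THE FAST CENSUS VALUE FROM TRUE SUB-CELLS: a table `T` of raw prefixes of length `≤ u` (a decidable shape check) whose entries are true sub-cell values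
`cellV u r B w = v` gives `shVF u r B = dfsVT … T shS0K u [] 0` — the right-hand side searches only above the table. [cite: MadrasSlade1993, Definition 1.2.4; lane lemma] -/
theorem shVF_eq_dfsVT_of_cells (u r B : ℕ) (T : List (List (ℕ × Bool) × ℕ)) (hshape : (T.all fun e => decide (e.1.length ≤ u)) = true)
    (hcells : ∀ e ∈ T, cellV u r B e.1 = e.2) : shVF u r B = dfsVT alwR (shUpdK (u + 1)) (shOkK u r) (fastLeafK u B) T shS0K u [] 0 := by
  refine shVF_eq_dfsVT u r B T fun e he => ⟨?_, hcells e he⟩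
  have h := List.all_eq_true.1 hshape e he
  simpa using h

end readoff

/-! ### §6 Self-test: the grouped excess-four counts at `u = 8` by the fast route -/

section selftest

/-- Fast census table at `u = 8`, `j = 4` (rows = break count `b ≤ 8`, columns = axes `k ≤ 8`): the reduced grouped counts `(81, 213, 315, 216, 60)` at
`k = 4`, i.e. `M(8, ·) = 16 · (81, 213, 315, 216, 60) = (1296, 3408, 5040, 3456, 960)` of `SAWCountZdFifthCoefficient.shM_eq_lit`.
[cite: MadrasSlade1993, Definition 1.2.4; lane census] -/
def fTab8 : List (List ℕ) :=
  [[0, 0, 0, 0, 0, 0, 0, 0, 0], [0, 0, 0, 0, 81, 0, 0, 0, 0], [0, 0, 0, 0, 213, 0, 0, 0, 0], [0, 0, 0, 0, 315, 0, 0, 0, 0],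
    [0, 0, 0, 0, 216, 0, 0, 0, 0], [0, 0, 0, 0, 60, 0, 0, 0, 0], [0, 0, 0, 0, 0, 0, 0, 0, 0], [0, 0, 0, 0, 0, 0, 0, 0, 0],
    [0, 0, 0, 0, 0, 0, 0, 0, 0]]

/-- ★ KERNEL CELL (fast engine, `u = 8`, `j = 4`): ONE evaluation, `9 × 9` digits, replaces the `128`-class cell `shV_eight` / `shVK_eight`.
[cite: MadrasSlade1993, Definition 1.2.4; lane census] -/
theorem shVF_eight_four : shVF 8 4 (2 ^ 60) = Nat.ofDigits ((2 ^ 60) ^ 9) (fTab8.map (Nat.ofDigits (2 ^ 60))) := by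
  decide +kernel

open Classical in
/-- ★★ SELF-TEST — THE GROUPED EXCESS-FOUR COUNTS AT `u = 8` BY THE FAST ROUTE: `Σ_{c : breaks = b} #shapeClass_4(8, A_c) = 16 · (0, 81, 213, 315, 216, 60, 0, 0, 0)_b`,
the kernel facts `M(8, ·)` of `shM_eq_lit` re-derived through the fast weighted keyed engine. [cite: MadrasSlade1993, Definition 1.2.4; §1.1 eq. (1.1.8) p. 5; lane census] -/
theorem sum_card_shapeClass_eight_four (b : ℕ) (hb : b ≤ 8) :
    ∑ c ∈ Finset.range (2 ^ (8 - 1)), (if breaksN 8 c = b then (shapeClass 4 8 (adjOf 8 c)).card else 0) =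
      2 ^ (8 - 4) * ((fTab8.getD b []).getD (8 - 4) 0) :=
  sum_card_shapeClass_eq_of_shVF 4 8 (2 ^ 60) (by norm_num) (by norm_num) fTab8 rfl (by decide) (by decide) shVF_eight_four b hb

end selftest

end WordTypes

end Literature.Probability.RandomPlanarGeometry.SAW.Zd
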